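import Literature.NumberTheory.Automorphic.UnitaryAntidiagFrames
import HarnessLib

/-!
# Unitary transvections of `(K^N, J₀ = antidiag(1,…,1))` (Tits 1979 §3.3; O'Meara §42D)

Topic `NumberTheory/Automorphic`; namespace `Literature.NumberTheory.Automorphic.HermitianLattice`.
Plumbing definitions (`transv`, `transvDual`, `transvEquiv`) and fully proved lemmas; no named fact, no `sorry`.
Setting of `UnitaryAntidiagFrames`: `σ : K →+* K` an involution, `B₀ σ N` the form of `J₀`, `e i = Pi.single i 1`.

For an index `i` with `rev i ≠ i` and a vector `x` with `x i = 1` and `B₀ x x = 0`, the **unitary transvection**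
`transv σ N i x` is the linear map
`z ↦ z + z i • (x - e i) - (B₀ x z - z i * σ (x (rev i)) - z (rev i)) • e (rev i)`,
i.e. on the basis `e i ↦ x`, `e (rev i) ↦ e (rev i)`, `e k ↦ e k - σ (x (rev k)) • e (rev i)` — the unipotent
element of `U(J₀)` in the parabolic stabilising the isotropic line `K·e (rev i)` whose `i`-th column is `x`.

* `transv_single_self`, `transv_single_rev`, `transv_single_of_ne` — the values on the basis;
* `B₀_transv` — it is a `B₀`-isometry;
* `transv_mem_stdLattice`, `transv_mem_frame` — it preserves `𝒪^N` (for `x ∈ 𝒪^N`) and `K^S`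
  (for `x ∈ K^S`, `i, rev i ∈ S`);
* `transvDual` (`x̃ i = 1`, `x̃ (rev i) = σ (x (rev i))`, `x̃ k = -x k`), `transv_comp_transvDual` —
  `transv i x ∘ transv i x̃ = id`; `transvEquiv` — `transv` as a linear automorphism with inverse `transv i x̃`.

Used for the transitivity of `U(J₀)(𝒪)` on normalised hyperbolic pairs inside coordinate frames (lattice proof of
the Cartan decomposition of the quasi-split unitary group, file `HyperspecialUnitaryCartan`).

References: J. Tits, *Reductive groups over local fields*, PSPUM 33.1 (1979), §3.3.3 [Tits1979];
O. T. O'Meara, *Introduction to Quadratic Forms* (1963), §42D [Omeara1963].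
-/

noncomputable section

open scoped Valued WithZero

namespace Literature.NumberTheory.Automorphic.HermitianLattice

variable {K : Type*} [Field K] (σ : K →+* K) (N : ℕ)

/-- The **unitary transvection** attached to an index `i` and a vector `x` (meant: `x i = 1`, `B₀ x x = 0`,
`i ≠ rev i`): `z ↦ z + z i • (x - e i) - (B₀ x z - z i * σ (x (rev i)) - z (rev i)) • e (rev i)`. [cite: Tits1979, §3.3.3] -/
def transv (i : Fin N) (x : Fin N → K) : (Fin N → K) →ₗ[K] (Fin N → K) :=
  LinearMap.id + (LinearMap.proj i : (Fin N → K) →ₗ[K] K).smulRight (x - Pi.single i 1) -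
    (B₀ σ N x - σ (x (Fin.rev i)) • (LinearMap.proj i : (Fin N → K) →ₗ[K] K) -
      (LinearMap.proj (Fin.rev i) : (Fin N → K) →ₗ[K] K)).smulRight (Pi.single (Fin.rev i) 1)

/-- The vector `x̃` with `transv i x̃ = (transv i x)⁻¹`: `x̃ i = 1`, `x̃ (rev i) = σ (x (rev i))`, `x̃ k = -x k`
otherwise. [cite: Tits1979, §3.3.3] -/
def transvDual (i : Fin N) (x : Fin N → K) : Fin N → K :=
  fun k => if k = i then 1 else if k = Fin.rev i then σ (x (Fin.rev i)) else -x k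

variable {σ N}

/-- The formula for `transv`. [cite: Tits1979, §3.3.3] -/
theorem transv_apply (i : Fin N) (x z : Fin N → K) :
    transv σ N i x z = z + z i • (x - Pi.single i 1) -
      (B₀ σ N x z - z i * σ (x (Fin.rev i)) - z (Fin.rev i)) • Pi.single (Fin.rev i) 1 := by
  simp only [transv, LinearMap.sub_apply, LinearMap.add_apply, LinearMap.id_apply, LinearMap.smulRight_apply,
    LinearMap.proj_apply, LinearMap.smul_apply, smul_eq_mul, mul_comm (σ (x (Fin.rev i)))]

section Values

variable {i : Fin N} {x : Fin N → K}

/-- `transv i x (e i) = x`. [cite: Tits1979, §3.3.3] -/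
theorem transv_single_self (hi : Fin.rev i ≠ i) : transv σ N i x (Pi.single i 1) = x := by
  rw [transv_apply, Pi.single_eq_same, one_smul, one_mul, B₀_single_right, Pi.single_eq_of_ne hi, sub_self,
    sub_zero, zero_smul, sub_zero, add_sub_cancel]

/-- `transv i x (e (rev i)) = e (rev i)` when `x i = 1`. [cite: Tits1979, §3.3.3] -/
theorem transv_single_rev (hi : Fin.rev i ≠ i) (hx1 : x i = 1) :
    transv σ N i x (Pi.single (Fin.rev i) 1) = Pi.single (Fin.rev i) 1 := by
  rw [transv_apply, Pi.single_eq_of_ne hi.symm, zero_smul, add_zero, zero_mul, sub_zero, B₀_single_right,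
    Fin.rev_rev, hx1, map_one, Pi.single_eq_same, sub_self, zero_smul, sub_zero]

/-- `transv i x (e k) = e k - σ (x (rev k)) • e (rev i)` for `k ∉ {i, rev i}`. [cite: Tits1979, §3.3.3] -/
theorem transv_single_of_ne {k : Fin N} (hk : k ≠ i) (hk' : k ≠ Fin.rev i) :
    transv σ N i x (Pi.single k 1) = Pi.single k 1 - σ (x (Fin.rev k)) • Pi.single (Fin.rev i) 1 := by
  rw [transv_apply, Pi.single_eq_of_ne hk.symm, Pi.single_eq_of_ne hk'.symm, zero_smul, add_zero, zero_mul,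
    sub_zero, sub_zero, B₀_single_right]

/-- `transv i x (e k) = e k` when `k ∉ {i, rev i}` and `x (rev k) = 0`. [cite: Tits1979, §3.3.3] -/
theorem transv_single_of_eq_zero {k : Fin N} (hk : k ≠ i) (hk' : k ≠ Fin.rev i) (hxk : x (Fin.rev k) = 0) :
    transv σ N i x (Pi.single k 1) = Pi.single k 1 := by
  rw [transv_apply, Pi.single_eq_of_ne hk.symm, Pi.single_eq_of_ne hk'.symm, zero_smul, add_zero, zero_mul,
    sub_zero, sub_zero, B₀_single_right, hxk, map_zero, zero_smul, sub_zero]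

end Values

section Identities

variable {i : Fin N} {x : Fin N → K}

/-- **`transv i x` is a `B₀`-isometry** (`σ² = 1`, `rev i ≠ i`, `x i = 1`, `B₀ x x = 0`). [cite: Tits1979, §3.3.3] -/
theorem B₀_transv (hσ : ∀ a, σ (σ a) = a) (hi : Fin.rev i ≠ i) (hx1 : x i = 1) (hx0 : B₀ σ N x x = 0)
    (u v : Fin N → K) : B₀ σ N (transv σ N i x u) (transv σ N i x v) = B₀ σ N u v := by
  have hB := isHermitianForm_B₀ (N := N) hσ
  have h1 : B₀ σ N u x = σ (B₀ σ N x u) := (hB x u).symm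
  rw [transv_apply, transv_apply]
  simp only [map_add, map_sub, LinearMap.map_smulₛₗ, map_smul, LinearMap.add_apply, LinearMap.sub_apply,
    LinearMap.smul_apply, smul_eq_mul, B₀_single_left, B₀_single_right, Fin.rev_rev,
    hx0, hx1, h1, map_one, map_zero, map_sub, map_mul, hσ, Pi.single_eq_same,
    Pi.single_eq_of_ne hi, Pi.single_eq_of_ne hi.symm]
  ring

/-- `transv` maps `𝒪^N` into itself when `x ∈ 𝒪^N`. [cite: Tits1979, §3.3.3] -/
theorem transv_mem_stdLattice [Valued K ℤᵐ⁰] (hvσ : ∀ a, Valued.v (σ a) = Valued.v a)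
    (hx : x ∈ stdLattice K N) {z : Fin N → K} (hz : z ∈ stdLattice K N) :
    transv σ N i x z ∈ stdLattice K N := by
  rw [transv_apply]
  have hc : Valued.v (B₀ σ N x z - z i * σ (x (Fin.rev i)) - z (Fin.rev i)) ≤ 1 := by
    refine (Valuation.map_sub _ _ _).trans (max_le ((Valuation.map_sub _ _ _).trans (max_le ?_ ?_)) (hz _))
    · exact v_B₀_le_one hvσ hx hz
    · rw [map_mul, hvσ]; exact mul_le_one' (hz i) (hx _)
  exact (stdLattice K N).sub_mem ((stdLattice K N).add_mem hz (smul_mem_of_v_le _ (hz i)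
    ((stdLattice K N).sub_mem hx (single_mem_stdLattice i)))) (smul_mem_of_v_le _ hc (single_mem_stdLattice _))

/-- `transv` preserves the coordinate subspace `K^S` when `x ∈ K^S` and `i, rev i ∈ S`. [cite: Tits1979, §3.3.3] -/
theorem transv_mem_frame {S : Finset (Fin N)} (hiS : i ∈ S) (hiS' : Fin.rev i ∈ S) (hx : x ∈ frame K N S)
    {z : Fin N → K} (hz : z ∈ frame K N S) : transv σ N i x z ∈ frame K N S := by
  rw [transv_apply]
  exact (frame K N S).sub_mem ((frame K N S).add_mem hz ((frame K N S).smul_mem _ ((frame K N S).sub_mem hx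
    (single_mem_frame hiS)))) ((frame K N S).smul_mem _ (single_mem_frame hiS'))

/-- `x̃ i = 1`. [cite: Tits1979, §3.3.3] -/
theorem transvDual_self : transvDual σ N i x i = 1 := by simp [transvDual]

/-- `x̃ (rev i) = σ (x (rev i))`. [cite: Tits1979, §3.3.3] -/
theorem transvDual_rev (hi : Fin.rev i ≠ i) : transvDual σ N i x (Fin.rev i) = σ (x (Fin.rev i)) := by
  simp [transvDual, hi]

/-- `x̃ k = - x k` off `{i, rev i}`. [cite: Tits1979, §3.3.3] -/
theorem transvDual_of_ne {k : Fin N} (hk : k ≠ i) (hk' : k ≠ Fin.rev i) : transvDual σ N i x k = -x k := by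
  simp [transvDual, hk, hk']

/-- The sum of `σ (x k) x (rev k)` over `k ∉ {i, rev i}` is `-(x (rev i) + σ (x (rev i)))` (isotropy of `x`).
[cite: Tits1979, §3.3.3] -/
theorem sum_erase_eq_neg (hi : Fin.rev i ≠ i) (hx1 : x i = 1) (hx0 : B₀ σ N x x = 0) :
    ∑ k ∈ (Finset.univ.erase i).erase (Fin.rev i), σ (x k) * x (Fin.rev k) = -(x (Fin.rev i) + σ (x (Fin.rev i))) := by
  have h0 := hx0
  rw [B₀_eq_add_add_sum hi, hx1, map_one, one_mul, mul_one] at h0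
  linear_combination h0

/-- `B₀ x x̃ = x (rev i) + 3·σ… precisely `x (rev i) + σ (x (rev i)) + 2 σ (x (rev i))`. [cite: Tits1979, §3.3.3] -/
theorem B₀_self_transvDual (hi : Fin.rev i ≠ i) (hx1 : x i = 1) (hx0 : B₀ σ N x x = 0) :
    B₀ σ N x (transvDual σ N i x) = x (Fin.rev i) + σ (x (Fin.rev i)) + 2 * σ (x (Fin.rev i)) := by
  rw [B₀_eq_add_add_sum hi, transvDual_self, transvDual_rev hi, hx1, map_one, one_mul, mul_one]
  have hS : ∑ k ∈ (Finset.univ.erase i).erase (Fin.rev i), σ (x k) * transvDual σ N i x (Fin.rev k) =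
      -∑ k ∈ (Finset.univ.erase i).erase (Fin.rev i), σ (x k) * x (Fin.rev k) := by
    rw [← Finset.sum_neg_distrib]
    refine Finset.sum_congr rfl fun k hk => ?_
    obtain ⟨hk1, hk2⟩ := mem_erase_erase.1 hk
    rw [transvDual_of_ne (fun h => hk2 (by rw [← h, Fin.rev_rev])) (fun h => hk1 (Fin.rev_injective h)), mul_neg]
  rw [hS, sum_erase_eq_neg hi hx1 hx0]
  ring

/-- `x̃` is isotropic. [cite: Tits1979, §3.3.3] -/
theorem B₀_transvDual_transvDual (hσ : ∀ a, σ (σ a) = a) (hi : Fin.rev i ≠ i) (hx1 : x i = 1)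
    (hx0 : B₀ σ N x x = 0) : B₀ σ N (transvDual σ N i x) (transvDual σ N i x) = 0 := by
  rw [B₀_eq_add_add_sum hi, transvDual_self, transvDual_rev hi, hσ, map_one, one_mul, mul_one]
  have hS : ∑ k ∈ (Finset.univ.erase i).erase (Fin.rev i), σ (transvDual σ N i x k) * transvDual σ N i x (Fin.rev k) =
      ∑ k ∈ (Finset.univ.erase i).erase (Fin.rev i), σ (x k) * x (Fin.rev k) := by
    refine Finset.sum_congr rfl fun k hk => ?_
    obtain ⟨hk1, hk2⟩ := mem_erase_erase.1 hk
    rw [transvDual_of_ne hk1 hk2,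
      transvDual_of_ne (fun h => hk2 (by rw [← h, Fin.rev_rev])) (fun h => hk1 (Fin.rev_injective h)), map_neg,
      neg_mul_neg]
  rw [hS, sum_erase_eq_neg hi hx1 hx0]
  ring

/-- `x̃̃ = x`. [cite: Tits1979, §3.3.3] -/
theorem transvDual_transvDual (hσ : ∀ a, σ (σ a) = a) (hi : Fin.rev i ≠ i) (hx1 : x i = 1) :
    transvDual σ N i (transvDual σ N i x) = x := by
  ext k
  by_cases hk : k = i
  · rw [hk, transvDual_self, hx1]
  by_cases hk' : k = Fin.rev i
  · rw [hk', transvDual_rev hi, transvDual_rev hi, hσ]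
  · rw [transvDual_of_ne hk hk', transvDual_of_ne hk hk', neg_neg]

/-- `transv i x x̃ = e i`. [cite: Tits1979, §3.3.3] -/
theorem transv_self_transvDual (hi : Fin.rev i ≠ i) (hx1 : x i = 1) (hx0 : B₀ σ N x x = 0) :
    transv σ N i x (transvDual σ N i x) = Pi.single i 1 := by
  have hi' : ¬ i = Fin.rev i := fun h => hi h.symm
  rw [transv_apply, transvDual_self, transvDual_rev hi, one_smul, one_mul, B₀_self_transvDual hi hx1 hx0]
  ext k
  simp only [Pi.add_apply, Pi.sub_apply, Pi.smul_apply, smul_eq_mul, Pi.single_apply]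
  by_cases hk : k = i
  · rw [hk, transvDual_self, hx1, if_pos rfl, if_neg hi']; ring
  by_cases hk' : k = Fin.rev i
  · rw [hk', transvDual_rev hi, if_neg hi, if_pos rfl]; ring
  · rw [transvDual_of_ne hk hk', if_neg hk, if_neg hk']; ring

/-- **`transv i x ∘ transv i x̃ = id`.** [cite: Tits1979, §3.3.3] -/
theorem transv_comp_transvDual (hi : Fin.rev i ≠ i) (hx1 : x i = 1) (hx0 : B₀ σ N x x = 0) :
    (transv σ N i x).comp (transv σ N i (transvDual σ N i x)) = LinearMap.id := by
  refine (Pi.basisFun K (Fin N)).ext fun k => ?_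
  rw [LinearMap.comp_apply, LinearMap.id_apply, Pi.basisFun_apply]
  by_cases hk : k = i
  · rw [hk, transv_single_self hi, transv_self_transvDual hi hx1 hx0]
  by_cases hk' : k = Fin.rev i
  · rw [hk', transv_single_rev hi transvDual_self, transv_single_rev hi hx1]
  · rw [transv_single_of_ne hk hk', map_sub, map_smul, transv_single_of_ne hk hk', transv_single_rev hi hx1,
      transvDual_of_ne (fun h => hk' (by rw [← h, Fin.rev_rev])) (fun h => hk (Fin.rev_injective h)), map_neg,
      neg_smul, sub_neg_eq_add, sub_add_cancel]

/-- `transv i x̃ ∘ transv i x = id`. [cite: Tits1979, §3.3.3] -/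
theorem transvDual_comp_transv (hσ : ∀ a, σ (σ a) = a) (hi : Fin.rev i ≠ i) (hx1 : x i = 1)
    (hx0 : B₀ σ N x x = 0) : (transv σ N i (transvDual σ N i x)).comp (transv σ N i x) = LinearMap.id := by
  have h := transv_comp_transvDual hi (x := transvDual σ N i x) transvDual_self
    (B₀_transvDual_transvDual hσ hi hx1 hx0)
  rwa [transvDual_transvDual hσ hi hx1] at h

/-- **The unitary transvection as a linear automorphism** (inverse `transv i x̃`). [cite: Tits1979, §3.3.3] -/
def transvEquiv (hσ : ∀ a, σ (σ a) = a) (hi : Fin.rev i ≠ i) (hx1 : x i = 1) (hx0 : B₀ σ N x x = 0) :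
    (Fin N → K) ≃ₗ[K] (Fin N → K) :=
  LinearEquiv.ofLinear (transv σ N i x) (transv σ N i (transvDual σ N i x))
    (transv_comp_transvDual hi hx1 hx0) (transvDual_comp_transv hσ hi hx1 hx0)

variable (hσ : ∀ a, σ (σ a) = a) (hi : Fin.rev i ≠ i) (hx1 : x i = 1) (hx0 : B₀ σ N x x = 0)

include hσ hi hx1 hx0 in
/-- `transvEquiv` is `transv`. [cite: Tits1979, §3.3.3] -/
@[simp] theorem transvEquiv_apply (z : Fin N → K) : transvEquiv hσ hi hx1 hx0 z = transv σ N i x z := rfl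

include hσ hi hx1 hx0 in
/-- `transvEquiv.symm` is `transv i x̃`. [cite: Tits1979, §3.3.3] -/
@[simp] theorem transvEquiv_symm_apply (z : Fin N → K) :
    (transvEquiv hσ hi hx1 hx0).symm z = transv σ N i (transvDual σ N i x) z := rfl

include hi in
/-- `x̃ ∈ 𝒪^N` when `x ∈ 𝒪^N`. [cite: Tits1979, §3.3.3] -/
theorem transvDual_mem_stdLattice [Valued K ℤᵐ⁰] (hvσ : ∀ a, Valued.v (σ a) = Valued.v a)
    (hx : x ∈ stdLattice K N) : transvDual σ N i x ∈ stdLattice K N := by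
  intro k
  by_cases hk : k = i
  · rw [hk, transvDual_self, map_one]
  by_cases hk' : k = Fin.rev i
  · rw [hk', transvDual_rev hi, hvσ]; exact hx _
  · rw [transvDual_of_ne hk hk', Valuation.map_neg]; exact hx k

/-- `x̃ ∈ K^S` when `x ∈ K^S` and `i, rev i ∈ S`. [cite: Tits1979, §3.3.3] -/
theorem transvDual_mem_frame {S : Finset (Fin N)} (hiS : i ∈ S) (hiS' : Fin.rev i ∈ S) (hx : x ∈ frame K N S) :
    transvDual σ N i x ∈ frame K N S := by
  intro k hk
  have hk1 : k ≠ i := fun h => hk (h ▸ hiS)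
  have hk2 : k ≠ Fin.rev i := fun h => hk (h ▸ hiS')
  rw [transvDual_of_ne hk1 hk2, hx k hk, neg_zero]

include hσ hi hx1 hx0 in
/-- **`transvEquiv` maps `𝒪^N` onto itself** (`x ∈ 𝒪^N`). [cite: Tits1979, §3.3.3] -/
theorem map_transvEquiv_stdLattice [Valued K ℤᵐ⁰] (hvσ : ∀ a, Valued.v (σ a) = Valued.v a)
    (hx : x ∈ stdLattice K N) :
    (stdLattice K N).map ((transvEquiv hσ hi hx1 hx0).toLinearMap.restrictScalars 𝒪[K]) = stdLattice K N := by
  apply le_antisymm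
  · rintro _ ⟨z, hz, rfl⟩
    exact transv_mem_stdLattice hvσ hx hz
  · intro z hz
    refine ⟨(transvEquiv hσ hi hx1 hx0).symm z, ?_, LinearEquiv.apply_symm_apply _ z⟩
    exact transv_mem_stdLattice hvσ (transvDual_mem_stdLattice hi hvσ hx) hz

include hσ hi hx1 hx0 in
/-- **`transvEquiv` maps `K^S` onto itself** (`x ∈ K^S`, `i, rev i ∈ S`). [cite: Tits1979, §3.3.3] -/
theorem map_transvEquiv_frame {S : Finset (Fin N)} (hiS : i ∈ S) (hiS' : Fin.rev i ∈ S) (hx : x ∈ frame K N S) :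
    (frame K N S).map (transvEquiv hσ hi hx1 hx0).toLinearMap = frame K N S := by
  apply le_antisymm
  · rintro _ ⟨z, hz, rfl⟩
    exact transv_mem_frame hiS hiS' hx hz
  · intro z hz
    refine ⟨(transvEquiv hσ hi hx1 hx0).symm z, ?_, LinearEquiv.apply_symm_apply _ z⟩
    exact transv_mem_frame hiS hiS' (transvDual_mem_frame hiS hiS' hx) hz

end Identities

end Literature.NumberTheory.Automorphic.HermitianLattice

end
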